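import Literature.AlgebraicGeometry.HodgeTheory.DirectImageBaseChangeContinuous
import Literature.AlgebraicGeometry.HodgeTheory.IsoTransport
import Mathlib.Topology.Homotopy.Lifting
import HarnessLib

/-!
# Continuations along paths that lift to a base change carrying a global class

Family `hodge`, layer `Literature/AlgebraicGeometry/HodgeTheory`; theorems only (no definition, no
named fact). Companion of `DirectImageBaseChangeContinuous.lean` (transfer of continuations along an
arbitrary base change `g : S' ⟶ S`).

The situation formalised here is the elementary half of "algebraic classes have algebraic
monodromy translates" (Voisin, *Hodge loci and absolute Hodge classes*, §3, proof of Prop. 0.7;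
Charles–Schnell, Thm. 11.3.19; Voisin II §3.1.2): let `π : 𝒳 ⟶ S` be a family whose `Rᵏ π_* ℂ` is
a local system, `g : S' ⟶ S` a morphism of bases (typically a finite étale cover of a Zariski open
subset of `S`) and `A ∈ Hᵏ((𝒳 ×_S S')(ℂ); ℂ)` a GLOBAL class on the base-changed total space (the
class of a relative cycle spread over the cover). Then:

* `IsContinuationAlong.unique` — flat continuation along a fixed path is unique (lifts to the
  étalé space of a local system are unique; Hatcher Prop. 1.34);
* `IsContinuationAlong.eq_baseChange_globalSection` — a continuation, along the image `g ∘ γ'` of a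
  path `γ'` of `S'(ℂ)`, of the transfer of `A|_{X'_{γ'(0)}}` IS the transfer of `A|_{X'_{γ'(1)}}`
  (the fibre restrictions of `A` form a flat section over `S'(ℂ)`, `isContinuationAlong_globalSection`;
  push it down by `IsContinuationAlong.baseChange`; uniqueness);
* `exists_path_lift_of_isCoveringMapOn` — path lifting for a map that is a covering map over a
  subset `U` of the base, for paths inside `U` (Mathlib's `IsCoveringMap.exists_path_lifts` on the
  restriction over `U`);
* `IsContinuationAlong.exists_eq_baseChange_globalSection_of_isCoveringMapOn` — hence, if `g(ℂ)` is
  a covering map over `U ⊆ S(ℂ)`, EVERY continuation of the transfer of `A|_{X'_{s'}}` along a path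
  inside `U` is the transfer of some fibre restriction `A|_{X'_{t'}}`, `g t' =` the endpoint;
* `IsContinuationAlong.isOfHodgeType_of_globalSection_of_isCoveringMapOn` — in particular, if all
  fibre restrictions of `A` over the endpoint are of Hodge type `(p, q)`, so is every such
  continuation (Hodge type is transported along the fibre identifications
  `X'_{t'} ≅ X_{g t'}`, `isOfHodgeType_map_iff_of_iso`).

This is the form in which "a Hodge class that extends to an algebraic (hence flat, Hodge) class over
a finite cover of a neighbourhood of the generic point is stable under the monodromy of that
neighbourhood" enters the comparison of Hodge loci with their Galois conjugates.

## References

* [Voisin2007HodgeLoci] C. Voisin, Hodge loci and absolute Hodge classes, Compositio Math. 143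
  (2007), §3, proof of Prop. 0.7.
* [CharlesSchnell2014Notes] F. Charles, C. Schnell, Notes on absolute Hodge classes (2014),
  Thm. 11.3.19 and its proof.
* [VoisinHodgeII2003] C. Voisin, Hodge Theory and Complex Algebraic Geometry II, CUP 2003, §3.1.2.
* [HatcherAT2002] A. Hatcher, Algebraic Topology, CUP 2002, Prop. 1.30, Prop. 1.34.

#harness_tags hodge.monodromy, hodge.continuation, hodge.stub_A
-/

noncomputable section

open CategoryTheory AlgebraicGeometry
open _root_.Topology unitInterval
open Literature.AlgebraicTopology.SingularHomology

/-! ### Path lifting over a subset of the base -/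

section Covering

variable {E X : Type*} [TopologicalSpace E] [TopologicalSpace X] {p : E → X} {U : Set X}

/-- **Path lifting over part of the base.** If `p : E → X` is a covering map over `U ⊆ X`, every
path of `X` inside `U` lifts through any point of `E` over its source (Mathlib's
`IsCoveringMap.exists_path_lifts` for the restriction `p⁻¹(U) → U`, which is a covering map,
`IsCoveringMapOn.isCoveringMap_restrictPreimage`). [cite: HatcherAT2002, Prop. 1.30] -/
theorem exists_path_lift_of_isCoveringMapOn (hp : IsCoveringMapOn p U) {x y : X} (γ : Path x y)
    (hγ : ∀ u, γ u ∈ U) (e : E) (he : p e = x) :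
    ∃ (e' : E) (γ' : Path e e'), ∀ u, p (γ' u) = γ u := by
  have cov : IsCoveringMap (U.restrictPreimage p) := hp.isCoveringMap_restrictPreimage
  have heU : e ∈ p ⁻¹' U := by
    rw [Set.mem_preimage, he, ← γ.source]
    exact hγ 0
  let δ : C(I, U) := ⟨fun u ↦ ⟨γ u, hγ u⟩, γ.continuous.subtype_mk _⟩
  have h0 : δ 0 = U.restrictPreimage p ⟨e, heU⟩ := Subtype.ext (by simp [δ, he])
  obtain ⟨Γ, hΓ, hΓ0⟩ := cov.exists_path_lifts δ ⟨e, heU⟩ h0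
  refine ⟨(Γ 1).1,
    { toFun := fun u ↦ (Γ u).1
      continuous_toFun := continuous_subtype_val.comp Γ.continuous
      source' := by simp [hΓ0]
      target' := rfl }, fun u ↦ ?_⟩
  have hu := congr_fun hΓ u
  simp only [Function.comp_apply] at hu
  exact congrArg Subtype.val hu

end Covering

namespace Literature.AlgebraicGeometry.HodgeTheory

section HodgeTheory

variable {𝒳 S S' : Motives.SchemeOver ℂ} (π : 𝒳 ⟶ S) (g : S' ⟶ S)

/-! ### Uniqueness of continuations -/

/-- **Flat continuation along a fixed path is unique** when `Rᵏ π_* ℂ` is a local system on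
`S(ℂ)`: both continuations are the transport of `α` along `γ` (`transportFun_eq_of_path`,
uniqueness of lifts to the covering space `FiberClass π k → S(ℂ)`).
[cite: HatcherAT2002, Prop. 1.34] [cite: VoisinHodgeII2003, §3.1.2] -/
theorem IsContinuationAlong.unique (k : ℕ)
    (hU : IsCohomologicallyLocallyTrivialOn π (Set.univ : Set (Motives.ComplexPoints S)))
    {s t : Motives.ComplexPoints S} {γ : Path s t} {α : complexBetti (Motives.fiberOver π s) k}
    {β₁ β₂ : complexBetti (Motives.fiberOver π t) k}
    (h₁ : IsContinuationAlong γ α β₁) (h₂ : IsContinuationAlong γ α β₂) : β₁ = β₂ := by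
  obtain ⟨Γ₁, hΓ₁⟩ := h₁
  obtain ⟨Γ₂, hΓ₂⟩ := h₂
  have e₁ := transportFun_eq_of_path π k hU (s := ⟨s, Set.mem_univ s⟩) (t := ⟨t, Set.mem_univ t⟩)
    (γ.map (continuous_id.subtype_mk fun x ↦ Set.mem_univ x)) Γ₁ fun u ↦ hΓ₁ u
  have e₂ := transportFun_eq_of_path π k hU (s := ⟨s, Set.mem_univ s⟩) (t := ⟨t, Set.mem_univ t⟩)
    (γ.map (continuous_id.subtype_mk fun x ↦ Set.mem_univ x)) Γ₂ fun u ↦ hΓ₂ u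
  rw [← e₁, ← e₂]

/-! ### Continuations of the transfer of a global class of the base change -/

/-- **A continuation along `g ∘ γ'` of the transfer of `A|_{X'_{γ'(0)}}` is the transfer of
`A|_{X'_{γ'(1)}}`**, for a global class `A ∈ Hᵏ((𝒳 ×_S S')(ℂ); ℂ)` of the base change and a path
`γ'` of `S'(ℂ)` (`π`, `π'` cohomologically locally trivial over `S(ℂ)`, `S'(ℂ)`): the fibre
restrictions of `A` are a flat section over `S'(ℂ)` (`isContinuationAlong_globalSection`), their
transfers a continuation along `g ∘ γ'` (`IsContinuationAlong.baseChange`), and continuations along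
a fixed path are unique. [cite: Voisin2007HodgeLoci, §3, proof of Prop. 0.7]
[cite: VoisinHodgeII2003, §3.1.2] -/
theorem IsContinuationAlong.eq_baseChange_globalSection
    (hU : IsCohomologicallyLocallyTrivialOn π (Set.univ : Set (Motives.ComplexPoints S)))
    (hU' : IsCohomologicallyLocallyTrivialOn (Motives.familyPullback.snd π g)
      (Set.univ : Set (Motives.ComplexPoints S'))) (k : ℕ)
    (A : complexBetti (Motives.familyPullback π g) k)
    {s' t' : Motives.ComplexPoints S'} (γ' : Path s' t')
    {β : complexBetti (Motives.fiberOver π (Motives.AlgPoints.map g t')) k}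
    (hβ : IsContinuationAlong (γ'.map (Motives.AlgPoints.continuous_map g))
      (complexBetti.map (Motives.fiberOverFamilyPullbackIso π g s').inv k
        (complexBetti.map (Motives.fiberι (Motives.familyPullback.snd π g) s') k A)) β) :
    β = complexBetti.map (Motives.fiberOverFamilyPullbackIso π g t').inv k
        (complexBetti.map (Motives.fiberι (Motives.familyPullback.snd π g) t') k A) :=
  IsContinuationAlong.unique π k hU hβ
    ((isContinuationAlong_globalSection (Motives.familyPullback.snd π g) k A γ').baseChange
      π g hU hU' k)

/-- The same, for a path `γ` of `S(ℂ)` given with a pointwise lift `γ'` to `S'(ℂ)` and phrased as an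
equality of fibre classes (no identification of base points needed): if `(s, α)` is the transfer of
`(s', A|_{X'_{s'}})` and `β` is a continuation of `α` along `γ`, then `(t, β)` is the transfer of
`(t', A|_{X'_{t'}})`. [cite: Voisin2007HodgeLoci, §3, proof of Prop. 0.7] -/
theorem IsContinuationAlong.mk_eq_baseChange_globalSection_of_lift
    (hU : IsCohomologicallyLocallyTrivialOn π (Set.univ : Set (Motives.ComplexPoints S)))
    (hU' : IsCohomologicallyLocallyTrivialOn (Motives.familyPullback.snd π g)
      (Set.univ : Set (Motives.ComplexPoints S'))) (k : ℕ)
    (A : complexBetti (Motives.familyPullback π g) k)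
    {s t : Motives.ComplexPoints S} {γ : Path s t} {s' t' : Motives.ComplexPoints S'}
    (γ' : Path s' t') (hlift : ∀ u, Motives.AlgPoints.map g (γ' u) = γ u)
    {α : complexBetti (Motives.fiberOver π s) k} {β : complexBetti (Motives.fiberOver π t) k}
    (hα : FiberClass.baseChange π g k (globalSection (Motives.familyPullback.snd π g) k A s') =
      ⟨s, α⟩)
    (hβ : IsContinuationAlong γ α β) :
    FiberClass.baseChange π g k (globalSection (Motives.familyPullback.snd π g) k A t') =
      ⟨t, β⟩ := by
  have hs : Motives.AlgPoints.map g s' = s := by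
    have h := congrArg FiberClass.pt hα
    rwa [FiberClass.pt_baseChange, pt_globalSection] at h
  have ht : Motives.AlgPoints.map g t' = t := by rw [← γ'.target, hlift 1, γ.target]
  subst hs ht
  have hγ : γ'.map (Motives.AlgPoints.continuous_map g) = γ := Path.ext (funext fun u ↦ hlift u)
  have hα' : α = complexBetti.map (Motives.fiberOverFamilyPullbackIso π g s').inv k
      (complexBetti.map (Motives.fiberι (Motives.familyPullback.snd π g) s') k A) := by
    have h := FiberClass.mk.inj hα.symm
    exact eq_of_heq h.2
  subst hα'
  rw [← hγ] at hβ
  have h := IsContinuationAlong.eq_baseChange_globalSection π g hU hU' k A γ' hβ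
  rw [h]
  rfl

/-- **Every continuation along a path inside `U` is a transfer of a fibre restriction of `A`, when
`g(ℂ)` is a covering map over `U`.** With `π`, `π'` cohomologically locally trivial: if
`(s, α)` is the transfer of `(s', A|_{X'_{s'}})`, `γ` is a path from `s` inside `U ⊆ S(ℂ)` over which
`g(ℂ)` is a covering map, and `β` is a continuation of `α` along `γ`, then `(γ(1), β)` is the transfer
of `(t', A|_{X'_{t'}})` for some `t' ∈ S'(ℂ)` (the endpoint of the lift of `γ` at `s'`).
[cite: Voisin2007HodgeLoci, §3, proof of Prop. 0.7] [cite: HatcherAT2002, Prop. 1.30] -/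
theorem IsContinuationAlong.exists_mk_eq_baseChange_globalSection_of_isCoveringMapOn
    (hU : IsCohomologicallyLocallyTrivialOn π (Set.univ : Set (Motives.ComplexPoints S)))
    (hU' : IsCohomologicallyLocallyTrivialOn (Motives.familyPullback.snd π g)
      (Set.univ : Set (Motives.ComplexPoints S'))) (k : ℕ)
    (A : complexBetti (Motives.familyPullback π g) k)
    {U : Set (Motives.ComplexPoints S)} (hcov : IsCoveringMapOn (Motives.AlgPoints.map g) U)
    {s t : Motives.ComplexPoints S} {γ : Path s t} (hγ : ∀ u, γ u ∈ U)
    {s' : Motives.ComplexPoints S'}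
    {α : complexBetti (Motives.fiberOver π s) k} {β : complexBetti (Motives.fiberOver π t) k}
    (hα : FiberClass.baseChange π g k (globalSection (Motives.familyPullback.snd π g) k A s') =
      ⟨s, α⟩)
    (hβ : IsContinuationAlong γ α β) :
    ∃ t' : Motives.ComplexPoints S',
      FiberClass.baseChange π g k (globalSection (Motives.familyPullback.snd π g) k A t') =
        ⟨t, β⟩ := by
  have hs : Motives.AlgPoints.map g s' = s := by
    have h := congrArg FiberClass.pt hα
    rwa [FiberClass.pt_baseChange, pt_globalSection] at h
  obtain ⟨t', γ', hlift⟩ := exists_path_lift_of_isCoveringMapOn hcov γ hγ s' hs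
  exact ⟨t', IsContinuationAlong.mk_eq_baseChange_globalSection_of_lift π g hU hU' k A γ' hlift hα hβ⟩

/-- **Hodge type of continuations from a global class on a cover.** Same setting; if moreover every
fibre restriction `A|_{X'_{t'}}` over the endpoint `t = γ(1)` (all `t'` with `g t' = t`) is of Hodge
type `(p, q)` on the smooth projective `X'_{t'}` (e.g. because `A` is the class of a relative
algebraic cycle), then every continuation `β` of `α` along `γ` is of Hodge type `(p, q)` on `X_t`:
`(t, β)` is the transfer of some `(t', A|_{X'_{t'}})`, and Hodge type is invariant under the fibre
identification `X'_{t'} ≅ X_{g t'}` (`isOfHodgeType_map_iff_of_iso`).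
[cite: Voisin2007HodgeLoci, §3, proof of Prop. 0.7] [cite: CharlesSchnell2014Notes, Thm. 11.3.19] -/
theorem IsContinuationAlong.isOfHodgeType_of_globalSection_of_isCoveringMapOn {n p q : ℕ}
    (hU : IsCohomologicallyLocallyTrivialOn π (Set.univ : Set (Motives.ComplexPoints S)))
    (hU' : IsCohomologicallyLocallyTrivialOn (Motives.familyPullback.snd π g)
      (Set.univ : Set (Motives.ComplexPoints S'))) (k : ℕ)
    (A : complexBetti (Motives.familyPullback π g) k)
    {U : Set (Motives.ComplexPoints S)} (hcov : IsCoveringMapOn (Motives.AlgPoints.map g) U)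
    {s t : Motives.ComplexPoints S} {γ : Path s t} (hγ : ∀ u, γ u ∈ U)
    {s' : Motives.ComplexPoints S'}
    {α : complexBetti (Motives.fiberOver π s) k} {β : complexBetti (Motives.fiberOver π t) k}
    (hα : FiberClass.baseChange π g k (globalSection (Motives.familyPullback.snd π g) k A s') =
      ⟨s, α⟩)
    (hA : ∀ t' : Motives.ComplexPoints S', Motives.AlgPoints.map g t' = t →
      IsOfHodgeType n (Motives.fiberOver (Motives.familyPullback.snd π g) t') k p q
        (complexBetti.map (Motives.fiberι (Motives.familyPullback.snd π g) t') k A))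
    (hβ : IsContinuationAlong γ α β) :
    IsOfHodgeType n (Motives.fiberOver π t) k p q β := by
  obtain ⟨t', ht'⟩ :=
    IsContinuationAlong.exists_mk_eq_baseChange_globalSection_of_isCoveringMapOn π g hU hU' k A
      hcov hγ hα hβ
  have ht : Motives.AlgPoints.map g t' = t := by
    have h := congrArg FiberClass.pt ht'
    rwa [FiberClass.pt_baseChange, pt_globalSection] at h
  have hA' := hA t' ht
  subst ht
  have hβ' : β = complexBetti.map (Motives.fiberOverFamilyPullbackIso π g t').inv k
      (complexBetti.map (Motives.fiberι (Motives.familyPullback.snd π g) t') k A) := by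
    have h := FiberClass.mk.inj ht'.symm
    exact eq_of_heq h.2
  rw [hβ', ← Iso.symm_hom]
  exact (isOfHodgeType_map_iff_of_iso (Motives.fiberOverFamilyPullbackIso π g t').symm).2 hA'

end HodgeTheory

end Literature.AlgebraicGeometry.HodgeTheory

end
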